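/-
Copyright: pub-hodgecm formalisation cell (harness21, 2026). New file (not vendored).
Origin: HOME/pub-hodgecm-pohl/lean/Pohl/Separation.lean — session planner-pub-hodgecm-pohl-0 (unit pub-hodgecm-pohl), part (b) `PohlmannSpan`.
Intended final place: `HodgeCM/Proofs/Pohlmann/Separation.lean` (module `HodgeCM.Proofs.Pohlmann.Separation`); WIP imports `Pohl.*` become the
`HodgeCM.*` modules named in the trailing comments.
Origin: expansion seat `planner-pub-hodgecm-pohl-0` (unit pub-hodgecm-pohl), handover v1 2026-08-18T03:16:01Z (`HOME/pub-hodgecm-pohl/lean/Pohl/Separation.lean`, md5 bcea228c);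
landed by the gen-5 packager as `HodgeCM/Proofs/Pohlmann/Separation.lean` (module `Pohl.Separation` → `HodgeCM.Proofs.Pohlmann.Separation`; body otherwise verbatim).
-/
import Mathlib.FieldTheory.PrimitiveElement
import Mathlib.FieldTheory.IsAlgClosed.Basic
import Mathlib.Analysis.Complex.Polynomial.Basic
import Mathlib.RingTheory.DedekindDomain.IntegralClosure
import Mathlib.NumberTheory.NumberField.Basic
import Mathlib.NumberTheory.NumberField.InfinitePlace.Embeddings
import Mathlib.Algebra.Polynomial.Roots
import Literature.NumberTheory.NumberFields.EmbeddingSeparation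

/-!
# Pohlmann's span theorem, II: separating the weights by one rational operator

Number theory of the CM field `F` (any number field here) used by the proof of
`HodgeCM.Universe.PohlmannSpan`: the characters
`S = (S_j)_j ↦ (a ↦ ∏_{s ∈ S_j} s(a))`, `a ∈ 𝓞_F` acting on the `j`-th factor of `A′ = ∏_j A_{Θ_j}`,
are pairwise distinct, and a single INTEGER combination of finitely many of them already separates all
weights `S`.  Consequently one endomorphism `T = Σ_i c_i · M_{j_i, a_i}^*` of `H^{2p}(A′, ℚ)` has the
weight spaces as its eigenspaces, with pairwise distinct eigenvalues (`exists_separating_family`).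

* `exists_ringOfIntegers_separating`: an algebraic integer `β ∈ 𝓞_F` with `s ↦ s(β)` injective on
  `Hom(F, ℂ)` (an integral multiple of a primitive element; Mathlib `Field.exists_primitive_element`,
  `Field.primitive_element_iff_algHom_eq_of_eval'`, `exists_integral_multiples`).
* `finset_eq_of_forall_prod_add_eq`: if `∏_{s ∈ S} (t + s β) = ∏_{s ∈ S'} (t + s β)` for every `t ∈ ℕ`
  then `S = S'` (two monic polynomials agreeing at infinitely many points have the same roots;
  `Polynomial.eq_of_infinite_eval_eq`, `Polynomial.roots_multiset_prod_X_sub_C`).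
* `exists_prod_ne`: hence distinct `S ≠ S'` are separated by `a = t + β ∈ 𝓞_F` for some `t`.
* `exists_nat_functional_injective`: finitely many points of `ℂ^ι` are separated by a functional with
  natural-number coefficients `c_i = t^{e(i)}` (`t` outside the finitely many roots of the difference
  polynomials along the moment curve).
-/

noncomputable section

open Polynomial
open scoped NumberField

namespace HodgeCM.Pohlmann

/-- Port anchor (port_pkg realias): every theorem of this ported file is now an `alias` of an already-landed tree declaration;
this file-unique trivial theorem keeps one genuine declaration in the file (gate lint; the literal is the source sha256 prefix). -/
theorem Separation_port_anchor : (4724859764263323885 : Nat) = 4724859764263323885 := rfl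


/-! ### An algebraic integer separating the complex embeddings -/

section Embeddings

variable {F : Type*} [Field F] [NumberField F]

/-- A number field has an algebraic integer `β` with `s ↦ s(β)` injective on `Hom(F, ℂ)`. -/
alias exists_ringOfIntegers_separating := Literature.NumberTheory.NumberFields.exists_ringOfIntegers_separating_embeddings

omit [NumberField F] in
/-- If `β` separates the embeddings and `∏_{s ∈ S} (t + s β) = ∏_{s ∈ S'} (t + s β)` for all `t ∈ ℕ`,
then `S = S'`. -/
alias finset_eq_of_forall_prod_add_eq := Literature.NumberTheory.NumberFields.finset_eq_of_forall_prod_add_eq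

/-- Distinct finite sets of embeddings have distinct product characters on `𝓞_F`:
some algebraic integer `a` has `∏_{s ∈ S} s(a) ≠ ∏_{s ∈ S'} s(a)`. -/
alias exists_prod_ne := Literature.NumberTheory.NumberFields.exists_ringOfIntegers_prod_embeddings_ne

end Embeddings

/-! ### A functional with natural-number coefficients separating finitely many complex points -/

section Generic

variable {𝒮 ι : Type*} [Finite 𝒮] [Fintype ι]

/-- Finitely many points of `ℂ^ι` (an injective `E : 𝒮 → ι → ℂ`, `𝒮` finite) are separated by one
functional `x ↦ Σ_i c_i x_i` with `c_i ∈ ℕ`. -/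
alias exists_nat_functional_injective := Literature.NumberTheory.NumberFields.exists_nat_functional_injective

end Generic

/-! ### One integer combination of factor characters separating all weights -/

section Family

variable {F : Type*} [Field F] [NumberField F]

/-- **Separation of weights.**  For weights `S = (S_j)_{j ≤ n}`, `S_j ⊆ Hom(F, ℂ)`, there are finitely
many pairs `(j_i, a_i)` (`a_i ∈ 𝓞_F` acting on the `j_i`-th factor) and coefficients `c_i ∈ ℕ` such that
`S ↦ Σ_i c_i ∏_{s ∈ S_{j_i}} s(a_i)` is injective.  (Index set: pairs of weights.) -/
alias exists_separating_family := Literature.NumberTheory.NumberFields.exists_separating_weight_functional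

end Family

end HodgeCM.Pohlmann

end
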